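import Summits.QuantumFields.YangMills.Theorems.IR.BetaSlopeFloorRungHaar
import Literature.MathematicalPhysics.QuantumFieldTheory.LatticeGaugeProofs

/-!
# Line `beta-slope-floor` (crux `IR`, stmt-QuantumFields-19354): vanishing of the doubled Haar moments

Route `BalabanLadder`, crux `IR`, line `beta-slope-floor` (registered stub `stub_rung_strongCoupling`), lead
prover `ym-ir-line-bsf-p1`.  The combinatorial heart of the ORDER-OF-VANISHING proof of the strong-coupling
rung.  On the torus `(ℤ/L)⁴` with product Haar measure on the DOUBLED link configuration
`W : Edge 4 L ⊕ Edge 4 L → G` (two independent copies `U = W ∘ inl`, `U' = W ∘ inr`), for a time-zero slice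
observable `F` and a time-`n` slice observable `G` (both functions of spatial links only) and the Wilson
action `S`:

  `∫ F(U) · (G(U) − G(U')) · (S(U) + S(U'))^j dW = 0`   for all `j < n`, `2n < L`

(`integral_doubledMoment_eq_zero`).  Mechanism (§2–§4): expand `(S(U)+S(U'))^j` over `j`-tuples of plaquettes;
by pigeonhole some forward time step `t < n` and some backward step `t' ≥ n` carry NO plaquette of the tuple
based at that time (`exists_free_steps`); the SLAB SWAP exchanging the two copies of every link inside the
time slab `(t, t']` (`slabSwap`) preserves product Haar measure, fixes `F` and every plaquette factor of the
tuple (each lies entirely inside or entirely outside the slab, `dTerm_slabSwap`), and exchanges `G(U)` with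
`G(U')` — so the integrand is odd and the integral vanishes.  Consequence (file 4 of the series): the
connected slice correlator `D_b(S, A, n)` vanishes at `b = 0` to order `≥ n`.

Honest framing: strong-coupling combinatorics on a finite torus, group-blind; nothing here bears on the
Yang–Mills mass gap (Clay).  R4 of the ladder closes only the conditional finite-𝕋⁴ rung `BalabanLadder.UV`.
Refs: K. Osterwalder, E. Seiler, Ann. Phys. 110 (1978) 440, §3 (strong-coupling cluster expansion: a
polymer must connect the supports); line card `Cruxes/IR/Lines/beta-slope-floor.md`.
-/

set_option autoImplicit false

noncomputable section

open MeasureTheory Function Classical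
open Literature.MathematicalPhysics.QuantumFieldTheory

namespace Summit.QuantumFields.YangMills.Cruxes.IR.BetaSlopeFloor

/-! ## §1 Time slabs on the torus and the slab swap of the doubled configuration -/

section Slab

variable {L : ℕ} {G : Type*}

/-- The time coordinate `τ : ℤ/L` lies in the slab `(t, t']` (read on representatives `0 ≤ val < L`). -/
def InSlab (t t' : ℕ) (τ : ZMod L) : Prop := t < τ.val ∧ τ.val ≤ t'

/-- A link of the torus `(ℤ/L)⁴` is SWAPPED iff it lies inside the time slab `(t, t']`: a spatial link
`(x, i)`, `i ≠ 0`, iff its time `x 0` does; a timelike link `(x, 0)` iff both its endpoints' times do. -/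
def InSwap (t t' : ℕ) (e : Edge 4 L) : Prop :=
  if e.2 = 0 then InSlab t t' (e.1 0) ∧ InSlab t t' (e.1 0 + 1) else InSlab t t' (e.1 0)

/-- The slab swap on doubled link indices: exchange the two copies of every swapped link. -/
def slabPerm (t t' : ℕ) : Edge 4 L ⊕ Edge 4 L → Edge 4 L ⊕ Edge 4 L :=
  Sum.elim (fun e => if InSwap t t' e then Sum.inr e else Sum.inl e)
    (fun e => if InSwap t t' e then Sum.inl e else Sum.inr e)

/-- The slab swap of indices is an involution. -/
theorem slabPerm_involutive (t t' : ℕ) : Involutive (slabPerm (L := L) t t') := by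
  intro i
  rcases i with e | e <;> by_cases h : InSwap t t' e <;> simp [slabPerm, h]

/-- The slab swap of indices as a permutation. -/
def slabEquiv (t t' : ℕ) : Equiv.Perm (Edge 4 L ⊕ Edge 4 L) :=
  (slabPerm_involutive (L := L) t t').toPerm _

/-- **The slab swap** of a doubled link configuration `W : Edge 4 L ⊕ Edge 4 L → G`: the two copies of every
link inside the time slab `(t, t']` are exchanged. -/
def slabSwap (t t' : ℕ) (W : Edge 4 L ⊕ Edge 4 L → G) : Edge 4 L ⊕ Edge 4 L → G :=
  fun i => W (slabPerm t t' i)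

/-- First copy of a swapped link after the swap = second copy before. -/
theorem slabSwap_inl_of {t t' : ℕ} {e : Edge 4 L} (h : InSwap t t' e) (W : Edge 4 L ⊕ Edge 4 L → G) :
    slabSwap t t' W (Sum.inl e) = W (Sum.inr e) := by simp [slabSwap, slabPerm, h]

/-- Second copy of a swapped link after the swap = first copy before. -/
theorem slabSwap_inr_of {t t' : ℕ} {e : Edge 4 L} (h : InSwap t t' e) (W : Edge 4 L ⊕ Edge 4 L → G) :
    slabSwap t t' W (Sum.inr e) = W (Sum.inl e) := by simp [slabSwap, slabPerm, h]

/-- Unswapped links are untouched (first copy). -/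
theorem slabSwap_inl_of_not {t t' : ℕ} {e : Edge 4 L} (h : ¬ InSwap t t' e)
    (W : Edge 4 L ⊕ Edge 4 L → G) : slabSwap t t' W (Sum.inl e) = W (Sum.inl e) := by
  simp [slabSwap, slabPerm, h]

/-- Unswapped links are untouched (second copy). -/
theorem slabSwap_inr_of_not {t t' : ℕ} {e : Edge 4 L} (h : ¬ InSwap t t' e)
    (W : Edge 4 L ⊕ Edge 4 L → G) : slabSwap t t' W (Sum.inr e) = W (Sum.inr e) := by
  simp [slabSwap, slabPerm, h]

/-! ## §2 Every plaquette away from the two cut steps lies inside or outside the slab -/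

/-- Time coordinate of a spatially shifted site. -/
theorem shift_time_of_ne (x : Site 4 L) {i : Fin 4} (hi : i ≠ 0) : (x.shift i) 0 = x 0 := by
  simp [Site.shift, Pi.single_eq_of_ne hi.symm]

/-- Time coordinate of the site shifted in time. -/
theorem shift_time_zero (x : Site 4 L) : (x.shift 0) 0 = x 0 + 1 := by
  simp [Site.shift]

/-- Representative of `τ + 1`. -/
theorem val_add_one [NeZero L] (hL : 1 < L) (τ : ZMod L) : (τ + 1).val = (τ.val + 1) % L := by
  haveI : Fact (1 < L) := ⟨hL⟩
  rw [ZMod.val_add, ZMod.val_one]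

/-- **Slab dichotomy for a time step.**  If the step `s = τ.val` is neither cut step (`s ≠ t`, `s ≠ t'`,
with `t < t' < L`), then the times `τ` and `τ + 1` are both inside the slab `(t, t']` or both outside. -/
theorem inSlab_iff_inSlab_add_one [NeZero L] (hL : 1 < L) {t t' : ℕ} (htt' : t < t') (ht'L : t' < L)
    (τ : ZMod L) (hst : τ.val ≠ t) (hst' : τ.val ≠ t') : InSlab t t' τ ↔ InSlab t t' (τ + 1) := by
  have hv := val_add_one hL τ
  have hτL : τ.val < L := ZMod.val_lt τ
  unfold InSlab
  rw [hv]
  rcases Nat.lt_or_ge (τ.val + 1) L with h | h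
  · rw [Nat.mod_eq_of_lt h]; omega
  · have h' : τ.val + 1 = L := by omega
    rw [h', Nat.mod_self]; omega

/-- A plaquette of the torus is FREE of the cut steps `t, t'` if it is not based at time `t` or `t'`. -/
def FreeOf (t t' : ℕ) (p : Plaquette 4 L) : Prop := (p.1 0).val ≠ t ∧ (p.1 0).val ≠ t'

/-- **A plaquette free of the cut steps has all four links swapped or none.** -/
theorem inSwap_edges_of_freeOf [NeZero L] (hL : 1 < L) {t t' : ℕ} (htt' : t < t') (ht'L : t' < L)
    {p : Plaquette 4 L} (hp : FreeOf t t' p) :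
    (InSwap t t' (p.1, p.2.1.1) ∧ InSwap t t' (p.1.shift p.2.1.1, p.2.1.2) ∧
        InSwap t t' (p.1.shift p.2.1.2, p.2.1.1) ∧ InSwap t t' (p.1, p.2.1.2)) ∨
      (¬ InSwap t t' (p.1, p.2.1.1) ∧ ¬ InSwap t t' (p.1.shift p.2.1.1, p.2.1.2) ∧
        ¬ InSwap t t' (p.1.shift p.2.1.2, p.2.1.1) ∧ ¬ InSwap t t' (p.1, p.2.1.2)) := by
  obtain ⟨x, ⟨⟨i, j⟩, hij⟩⟩ := p
  simp only at hij
  have hj : j ≠ 0 := by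
    rintro rfl; exact (Fin.not_lt_zero _ hij).elim
  obtain ⟨hst, hst'⟩ := hp
  simp only at hst hst' ⊢
  have key := inSlab_iff_inSlab_add_one hL htt' ht'L (x 0) hst hst'
  by_cases hi : i = 0
  · subst hi
    simp only [InSwap, if_true, hj, if_false, shift_time_zero, shift_time_of_ne x hj]
    tauto
  · simp only [InSwap, hi, if_false, hj, shift_time_of_ne x hi, shift_time_of_ne x hj]
    tauto

/-- A time-zero spatial link is never swapped. -/
theorem not_inSwap_of_time_zero {t t' : ℕ} {e : Edge 4 L} (he : e.1 0 = 0 ∧ e.2 ≠ 0) :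
    ¬ InSwap t t' e := by
  simp only [InSwap, he.2, if_false, InSlab, he.1, ZMod.val_zero]
  omega

/-- A time-`n` spatial link is swapped when `t < n ≤ t'` (`n < L`). -/
theorem inSwap_of_time_eq {t t' n : ℕ} (htn : t < n) (hnt' : n ≤ t') (hnL : n < L) {e : Edge 4 L}
    (he : e.1 0 = (n : ZMod L) ∧ e.2 ≠ 0) : InSwap t t' e := by
  simp only [InSwap, he.2, if_false, InSlab, he.1, ZMod.val_natCast, Nat.mod_eq_of_lt hnL]
  exact ⟨htn, hnt'⟩

/-- **Pigeonhole: free cut steps exist.**  A tuple of `j < n` plaquettes on the torus of time extent `L > 2n`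
misses some forward step `t < n` and some backward step `n ≤ t' < L`. -/
theorem exists_free_steps {n j : ℕ} (hjn : j < n) (hnL : 2 * n < L) (f : Fin j → Plaquette 4 L) :
    ∃ t t' : ℕ, t < n ∧ n ≤ t' ∧ t' < L ∧ ∀ k, FreeOf t t' (f k) := by
  set T : Finset ℕ := Finset.univ.image fun k : Fin j => ((f k).1 0).val with hT
  have hTcard : T.card ≤ j := by
    calc T.card ≤ (Finset.univ : Finset (Fin j)).card := Finset.card_image_le
      _ = j := by simp
  have h1 : T.card < (Finset.range n).card := by rw [Finset.card_range]; omega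
  have h2 : T.card < (Finset.Ico n L).card := by rw [Nat.card_Ico]; omega
  obtain ⟨t, ht, htT⟩ := Finset.exists_mem_notMem_of_card_lt_card h1
  obtain ⟨t', ht', ht'T⟩ := Finset.exists_mem_notMem_of_card_lt_card h2
  rw [Finset.mem_range] at ht
  rw [Finset.mem_Ico] at ht'
  refine ⟨t, t', ht, ht'.1, ht'.2, fun k => ⟨fun h => htT ?_, fun h => ht'T ?_⟩⟩
  · exact Finset.mem_image.2 ⟨k, Finset.mem_univ _, h⟩
  · exact Finset.mem_image.2 ⟨k, Finset.mem_univ _, h⟩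

end Slab

/-! ## §3 Doubled plaquette terms and the odd integrand -/

section Integrand

variable {L : ℕ} {G : Type*} [Group G] {N : ℕ} (ρ : G →* Matrix (Fin N) (Fin N) ℂ)

/-- The doubled plaquette term: the Wilson plaquette cost of `p` summed over the two copies. -/
def dTerm (p : Plaquette 4 L) (W : Edge 4 L ⊕ Edge 4 L → G) : ℝ :=
  plaquetteCost ρ (fun e => W (Sum.inl e)) p + plaquetteCost ρ (fun e => W (Sum.inr e)) p

/-- **Free plaquette factors are invariant under the slab swap** (each copy's cost is either unchanged or
traded with the other copy's). -/
theorem dTerm_slabSwap [NeZero L] (hL : 1 < L) {t t' : ℕ} (htt' : t < t') (ht'L : t' < L)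
    {p : Plaquette 4 L} (hp : FreeOf t t' p) (W : Edge 4 L ⊕ Edge 4 L → G) :
    dTerm ρ p (slabSwap t t' W) = dTerm ρ p W := by
  rcases inSwap_edges_of_freeOf hL htt' ht'L hp with ⟨h1, h2, h3, h4⟩ | ⟨h1, h2, h3, h4⟩
  · simp only [dTerm, plaquetteCost, plaquetteHolonomy, slabSwap_inl_of h1, slabSwap_inl_of h2,
      slabSwap_inl_of h3, slabSwap_inl_of h4, slabSwap_inr_of h1, slabSwap_inr_of h2,
      slabSwap_inr_of h3, slabSwap_inr_of h4]
    ring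
  · simp only [dTerm, plaquetteCost, plaquetteHolonomy, slabSwap_inl_of_not h1, slabSwap_inl_of_not h2,
      slabSwap_inl_of_not h3, slabSwap_inl_of_not h4, slabSwap_inr_of_not h1, slabSwap_inr_of_not h2,
      slabSwap_inr_of_not h3, slabSwap_inr_of_not h4]

/-- The Wilson action of a copy is the sum of its plaquette costs; the doubled action is the sum of the
doubled plaquette terms. -/
theorem wilsonAction_add_eq_sum_dTerm [NeZero L] (W : Edge 4 L ⊕ Edge 4 L → G) :
    wilsonAction ρ (fun e => W (Sum.inl e)) + wilsonAction ρ (fun e => W (Sum.inr e)) =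
      ∑ p : Plaquette 4 L, dTerm ρ p W := by
  simp only [wilsonAction, dTerm, plaquetteCost, ← Finset.sum_add_distrib]

/-- **The integrand is odd under the slab swap.**  If every plaquette of the tuple `f` is free of the cut
steps, the slice-`0` observable `F` is fixed, the slice-`n` observable `Gd` trades copies, and every
doubled plaquette factor is fixed. -/
theorem integrand_slabSwap [NeZero L] (hL : 1 < L) {t t' n : ℕ} (htn : t < n) (hnt' : n ≤ t')
    (ht'L : t' < L) {F Gd : GaugeConfig 4 L G → ℝ}
    (hF : DependsOn F {e : Edge 4 L | e.1 0 = 0 ∧ e.2 ≠ 0})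
    (hG : DependsOn Gd {e : Edge 4 L | e.1 0 = (n : ZMod L) ∧ e.2 ≠ 0})
    {j : ℕ} {f : Fin j → Plaquette 4 L} (hf : ∀ k, FreeOf t t' (f k)) (W : Edge 4 L ⊕ Edge 4 L → G) :
    F (fun e => slabSwap t t' W (Sum.inl e)) *
        (Gd (fun e => slabSwap t t' W (Sum.inl e)) - Gd (fun e => slabSwap t t' W (Sum.inr e))) *
          ∏ k, dTerm ρ (f k) (slabSwap t t' W) =
      -(F (fun e => W (Sum.inl e)) * (Gd (fun e => W (Sum.inl e)) - Gd (fun e => W (Sum.inr e))) *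
          ∏ k, dTerm ρ (f k) W) := by
  have hnL : n < L := lt_of_le_of_lt hnt' ht'L
  have h1 : F (fun e => slabSwap t t' W (Sum.inl e)) = F (fun e => W (Sum.inl e)) :=
    hF fun e he => slabSwap_inl_of_not (not_inSwap_of_time_zero he) W
  have h2 : Gd (fun e => slabSwap t t' W (Sum.inl e)) = Gd (fun e => W (Sum.inr e)) :=
    hG fun e he => slabSwap_inl_of (inSwap_of_time_eq htn hnt' hnL he) W
  have h3 : Gd (fun e => slabSwap t t' W (Sum.inr e)) = Gd (fun e => W (Sum.inl e)) :=
    hG fun e he => slabSwap_inr_of (inSwap_of_time_eq htn hnt' hnL he) W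
  have h4 : ∏ k, dTerm ρ (f k) (slabSwap t t' W) = ∏ k, dTerm ρ (f k) W :=
    Finset.prod_congr rfl fun k _ => dTerm_slabSwap ρ hL (lt_of_lt_of_le htn hnt') ht'L (hf k) W
  rw [h1, h2, h3, h4]
  ring

end Integrand

/-! ## §4 Vanishing of the doubled Haar moments -/

section Meas

variable {L : ℕ} {G : Type*} [MeasurableSpace G]

/-- The first copy is a measurable function of the doubled configuration. -/
theorem measurable_inl_copy :
    Measurable fun (W : Edge 4 L ⊕ Edge 4 L → G) (e : Edge 4 L) => W (Sum.inl e) :=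
  measurable_pi_lambda _ fun e => measurable_pi_apply (Sum.inl e)

/-- The second copy is a measurable function of the doubled configuration. -/
theorem measurable_inr_copy :
    Measurable fun (W : Edge 4 L ⊕ Edge 4 L → G) (e : Edge 4 L) => W (Sum.inr e) :=
  measurable_pi_lambda _ fun e => measurable_pi_apply (Sum.inr e)

end Meas

section Moments

variable {L : ℕ} {G : Type*} [Group G] [TopologicalSpace G] [IsTopologicalGroup G]
  [MeasurableSpace G] [BorelSpace G] [SecondCountableTopology G] {N : ℕ}
  (ρ : G →* Matrix (Fin N) (Fin N) ℂ)

/-- The plaquette cost is measurable (continuous representation). -/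
theorem measurable_plaquetteCost (hρ : Continuous ρ) (p : Plaquette 4 L) :
    Measurable fun U : GaugeConfig 4 L G => plaquetteCost ρ U p := by
  unfold plaquetteCost
  exact measurable_const.sub
    ((continuous_trace_re ρ hρ).measurable.comp (measurable_plaquetteHolonomy _ _ _))

/-- The doubled plaquette term is measurable. -/
theorem measurable_dTerm (hρ : Continuous ρ) (p : Plaquette 4 L) :
    Measurable (dTerm (L := L) ρ p) := by
  unfold dTerm
  exact ((measurable_plaquetteCost ρ hρ p).comp measurable_inl_copy).add
    ((measurable_plaquetteCost ρ hρ p).comp measurable_inr_copy)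

omit [IsTopologicalGroup G] [MeasurableSpace G] [BorelSpace G] [SecondCountableTopology G] in
/-- The plaquette cost is bounded on a compact group. -/
theorem exists_bound_plaquetteCost [CompactSpace G] (hρ : Continuous ρ) :
    ∃ B : ℝ, 0 ≤ B ∧ ∀ (U : GaugeConfig 4 L G) (p : Plaquette 4 L), |plaquetteCost ρ U p| ≤ B := by
  obtain ⟨B, hB0, hB⟩ := exists_bound_trace_re_nonneg (ρ := ρ) hρ
  refine ⟨N + B, by positivity, fun U p => ?_⟩
  unfold plaquetteCost
  calc |(N : ℝ) - (ρ (plaquetteHolonomy U p.1 p.2.1.1 p.2.1.2)).trace.re|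
      ≤ |(N : ℝ)| + |(ρ (plaquetteHolonomy U p.1 p.2.1.1 p.2.1.2)).trace.re| := abs_sub _ _
    _ ≤ N + B := by rw [Nat.abs_cast]; exact add_le_add le_rfl (hB _)

variable [CompactSpace G]

/-- **Vanishing of the doubled Haar moments** (the combinatorial heart of the strong-coupling rung).  On the
torus `(ℤ/L)⁴` with product Haar measure on the doubled link configuration, for a time-zero slice observable
`F`, a time-`n` slice observable `Gd` (`2n < L`) and every `j < n`:
`∫ F(U) (Gd(U) − Gd(U')) (S(U) + S(U'))^j d(U,U') = 0`. -/
theorem integral_doubledMoment_eq_zero [NeZero L] (hρ : Continuous ρ) {F Gd : GaugeConfig 4 L G → ℝ}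
    (hFm : Measurable F) (hGm : Measurable Gd) {CF CG : ℝ} (hFb : ∀ U, |F U| ≤ CF)
    (hGb : ∀ U, |Gd U| ≤ CG) (hF : DependsOn F {e : Edge 4 L | e.1 0 = 0 ∧ e.2 ≠ 0}) {n : ℕ}
    (hG : DependsOn Gd {e : Edge 4 L | e.1 0 = (n : ZMod L) ∧ e.2 ≠ 0}) (hnL : 2 * n < L) {j : ℕ}
    (hj : j < n) :
    ∫ W, F (fun e => W (Sum.inl e)) * (Gd (fun e => W (Sum.inl e)) - Gd (fun e => W (Sum.inr e))) *
        (wilsonAction ρ (fun e => W (Sum.inl e)) + wilsonAction ρ (fun e => W (Sum.inr e))) ^ j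
      ∂(Measure.pi fun _ : Edge 4 L ⊕ Edge 4 L => haarProbability G) = 0 := by
  have hL : 1 < L := by omega
  obtain ⟨B, hB0, hB⟩ := exists_bound_plaquetteCost (L := L) ρ hρ
  -- the prefactor `Φ = F (Gd − Gd')` is bounded and measurable
  set Φ : (Edge 4 L ⊕ Edge 4 L → G) → ℝ := fun W =>
    F (fun e => W (Sum.inl e)) * (Gd (fun e => W (Sum.inl e)) - Gd (fun e => W (Sum.inr e))) with hΦ
  have hΦm : Measurable Φ :=
    (hFm.comp measurable_inl_copy).mul ((hGm.comp measurable_inl_copy).sub (hGm.comp measurable_inr_copy))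
  have hCF : 0 ≤ CF := le_trans (abs_nonneg _) (hFb fun _ => 1)
  have hCG : 0 ≤ CG := le_trans (abs_nonneg _) (hGb fun _ => 1)
  have hΦb : ∀ W, |Φ W| ≤ CF * (2 * CG) := fun W => by
    have hg1 := hGb (fun e => W (Sum.inl e))
    have hg2 := hGb (fun e => W (Sum.inr e))
    have hsub : |Gd (fun e => W (Sum.inl e)) - Gd (fun e => W (Sum.inr e))| ≤ 2 * CG :=
      le_trans (abs_sub _ _) (by linarith)
    rw [hΦ, abs_mul]
    exact mul_le_mul (hFb _) hsub (abs_nonneg _) hCF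
  -- each doubled plaquette term is bounded by `2B`
  have hdB : ∀ (p : Plaquette 4 L) (W : Edge 4 L ⊕ Edge 4 L → G), |dTerm ρ p W| ≤ 2 * B := fun p W => by
    have h1 := hB (fun e => W (Sum.inl e)) p
    have h2 := hB (fun e => W (Sum.inr e)) p
    unfold dTerm
    exact le_trans (abs_add_le _ _) (by linarith)
  -- expand the power of the doubled action over tuples of plaquettes
  have hexp : ∀ W : Edge 4 L ⊕ Edge 4 L → G,
      Φ W * (wilsonAction ρ (fun e => W (Sum.inl e)) + wilsonAction ρ (fun e => W (Sum.inr e))) ^ j =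
        ∑ f : Fin j → Plaquette 4 L, Φ W * ∏ k, dTerm ρ (f k) W := fun W => by
    rw [wilsonAction_add_eq_sum_dTerm, Fintype.sum_pow, Finset.mul_sum]
  have hterm_meas : ∀ f : Fin j → Plaquette 4 L,
      Measurable fun W => Φ W * ∏ k, dTerm ρ (f k) W := fun f =>
    hΦm.mul (Finset.measurable_prod _ fun k _ => measurable_dTerm ρ hρ (f k))
  have hterm_int : ∀ f : Fin j → Plaquette 4 L,
      Integrable (fun W => Φ W * ∏ k, dTerm ρ (f k) W)
        (Measure.pi fun _ : Edge 4 L ⊕ Edge 4 L => haarProbability G) := fun f => by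
    refine Integrable.of_bound (C := CF * (2 * CG) * (2 * B) ^ j) (hterm_meas f).aestronglyMeasurable
      (ae_of_all _ fun W => ?_)
    rw [Real.norm_eq_abs, abs_mul, Finset.abs_prod]
    have hprod : ∏ k, |dTerm ρ (f k) W| ≤ (2 * B) ^ j := by
      calc ∏ k, |dTerm ρ (f k) W| ≤ ∏ _k : Fin j, (2 * B) :=
            Finset.prod_le_prod (fun _ _ => abs_nonneg _) fun k _ => hdB (f k) W
        _ = (2 * B) ^ j := by simp
    exact mul_le_mul (hΦb W) hprod (Finset.prod_nonneg fun _ _ => abs_nonneg _)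
      (mul_nonneg hCF (by linarith))
  -- every tuple's integral vanishes by the slab-swap symmetry
  have hvanish : ∀ f : Fin j → Plaquette 4 L,
      ∫ W, Φ W * ∏ k, dTerm ρ (f k) W ∂(Measure.pi fun _ : Edge 4 L ⊕ Edge 4 L => haarProbability G)
        = 0 := fun f => by
    obtain ⟨t, t', htn, hnt', ht'L, hfree⟩ := exists_free_steps hj hnL f
    have hodd : ∀ W, Φ (slabSwap t t' W) * ∏ k, dTerm ρ (f k) (slabSwap t t' W) =
        -(Φ W * ∏ k, dTerm ρ (f k) W) := fun W =>
      integrand_slabSwap ρ hL htn hnt' ht'L hF hG hfree W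
    have hinv := integral_comp_equiv (haarProbability G) (slabEquiv (L := L) t t') (hterm_meas f)
    have hswap : (fun W : Edge 4 L ⊕ Edge 4 L → G =>
        Φ (fun i => W (slabEquiv t t' i)) * ∏ k, dTerm ρ (f k) fun i => W (slabEquiv t t' i)) =
        fun W => -(Φ W * ∏ k, dTerm ρ (f k) W) := by
      funext W
      exact hodd W
    rw [hswap, integral_neg] at hinv
    linarith
  calc ∫ W, Φ W * (wilsonAction ρ (fun e => W (Sum.inl e)) +
          wilsonAction ρ (fun e => W (Sum.inr e))) ^ j
        ∂(Measure.pi fun _ : Edge 4 L ⊕ Edge 4 L => haarProbability G)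
      = ∫ W, ∑ f : Fin j → Plaquette 4 L, Φ W * ∏ k, dTerm ρ (f k) W
          ∂(Measure.pi fun _ : Edge 4 L ⊕ Edge 4 L => haarProbability G) :=
        integral_congr_ae (ae_of_all _ hexp)
    _ = ∑ f : Fin j → Plaquette 4 L, ∫ W, Φ W * ∏ k, dTerm ρ (f k) W
          ∂(Measure.pi fun _ : Edge 4 L ⊕ Edge 4 L => haarProbability G) :=
        integral_finsetSum _ fun f _ => hterm_int f
    _ = 0 := Finset.sum_eq_zero fun f _ => hvanish f

end Moments

end Summit.QuantumFields.YangMills.Cruxes.IR.BetaSlopeFloor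

end
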